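import Mathlib
import Summits.Langlands.Langlands.Theorems.QuadraticWindowHostInducedRepMemberArchGLOne
import Summits.Langlands.Langlands.Theorems.QuadraticWindowHostInducedRepMemberPaneArchGLOne
import Summits.Langlands.Langlands.Theorems.QuadraticWindowHostInducedRepPaneDefs
import Literature.NumberTheory.Automorphic.InfinityTypeAutomorphicInduction
import Literature.NumberTheory.Automorphic.BaseChangeArchimedean
import Literature.NumberTheory.Automorphic.AutomorphicTwistWeightOne
import Literature.NumberTheory.Automorphic.WeaklyRegularGaloisRep

/-!
# The infinity type of the member `τ' = Π_K ⊗ ψ₀` — sub-stub `stub_memberArch` of the member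
# statement `pkg_member` (stub `stub_package`, line `one-transparent-pane`, item stmt-Langlands-10902,
# crux `Summit.Langlands.Langlands.Theses.QuadraticWindow.HostInducedRep`)

LOG (wave-3 worker `stub_memberArch`, 2026-08-16): PROVED; the registered signature follows
`theorem stub_memberArch :` verbatim (last declaration); helper file `…MemberArchGLOne.lean`
(LANDED p100117, anchor `memberArchGLOne_anchor`: the `GL₁` twist, the exponential ideles, and the
exponents of `ψ₀` from the restriction identity); three named facts in front (`harch` =
Arthur–Clozel strong lifting at the archimedean places, `hHen` = Henniart's infinity type of an
automorphic induction, `hinf` = existence of infinity types), all existing Literature `def`s.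
v1 p102262 bounced (review): `infinitePlace_eq_of_comap_eq` duplicated the landed
`paneArch_eq_of_comap_eq` of `…MemberPaneArchGLOne.lean` (sibling worker) — now imported and used.

Statement (`ArchOut` of `…PaneDefs.lean`).  From the defining relations `MemberRel` of the member
objects (`Π = AI_{F/F₀}(π ⊗ ω)`, `Π_K = BC_{K/F₀}(Π)`, `τ' = Π_K ⊗ (ψ₀ ∘ det)`, `ψ₀ = ψu νk`,
`νk = ‖·‖^{k/2}`, `ν = ‖·‖^{-n/2}`, `ψu|_{𝔸_{F₀}} = χ₀ = (χe ω₀)⁻¹ μ` of finite order): an infinity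
type `T` of `τ'` which is weakly regular, and such that the parity hypothesis
`χ₀,v(-1) = (-1)^{n+k}` (all real `v`) makes `T` `C`-algebraic and `ψ₁ = ψ₀ ν` algebraic.

Proof.  `π` is regular algebraic (`Hyps`), with infinity type `T_π`; `π ⊗ ω` has the same
(`HasArchParameter.twist`, `ω` of finite order); `Π` has `T_π^{F/F₀}` (`hHen`,
`hasInfinityType_automorphicInduction`; `n ≥ 1` by the twist-nontriviality clause of `Hyps`);
`Π_K` has its base change (`harch`, `hasInfinityType_baseChange`); `τ'` has the shift by the
parameter `p` of the `GL₁` datum of `θ = ψu νk` (helper file).  At `σ : K → ℂ` the `z`-exponents are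
`{a_i(σ₁) + p σ} + {a_i(σ₂) + p σ}` over the two extensions `σ₁ ≠ σ₂` of `σ|_{F₀}` to `F`, each half
free of repetitions (`T_π` regular): weak regularity.  By the helper file, `p(σ_u) = (k + m_u)/2`,
`p(σ̄_u) = (k - m_u)/2` with `(-1)^{m_u} = χ₀,v(-1)`; under the parity hypothesis `m_u ≡ n + k`, so
`p σ ∈ n/2 + ℤ` for all `σ`, the exponents of `T` lie in `(n-1)/2 + n/2 + ℤ = (2n-1)/2 + ℤ`
(`C`-algebraic), and `ψ₁(γ_K(a_u)) = e^{a(k + j_u) - ā(j_u + n)}` with `m_u = n + k + 2 j_u`, whence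
`ψ₁((x,1)) = ∏_u ι_u(x_u)^{k + j_u} \overline{ι_u(x_u)}^{-j_u - n}` (all places of `K` are complex):
`ψ₁` is algebraic.
-/

open scoped BigOperators Polynomial Classical ComplexConjugate MatrixGroups Matrix
open Filter Polynomial IsDedekindDomain NumberField NumberField.InfinitePlace NumberField.mixedEmbedding
open Literature.NumberTheory.Automorphic Literature.NumberTheory.GaloisRepresentations
open Summit.Langlands.Langlands.Theorems.HostInducedRep.GrsExplicitDescent

-- `Summit.Langlands.Langlands.…` (summit = sub-problem name, D-0017 layout) trips `dupNamespace`.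
set_option linter.dupNamespace false

noncomputable section

namespace Summit.Langlands.Langlands.Theorems.HostInducedRep.OneTransparentPane

section Algebraic

variable {K : Type} [Field K] [NumberField K]

/-- **A Hecke character on the infinite ideles is the product of its archimedean components**:
`(x, 1) = ∏_w (x_w)_w`, so `χ((x, 1)) = ∏_w χ_w(x_w)` (the components `x_w ∈ K_wˣ` packaged as
units `y_w`). [folklore] -/
theorem heckeCharacter_infiniteIdeles_eq_prod (χ : HeckeCharacter K) (x : (InfiniteAdeleRing K)ˣ) :
    ∃ y : ∀ w : InfinitePlace K, (w.Completion)ˣ,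
      (∀ w, ((y w : (w.Completion)ˣ) : w.Completion) = (x : InfiniteAdeleRing K) w) ∧
      χ (infiniteIdeles K x) = ∏ w : InfinitePlace K, χ.archComponent w (y w) := by
  let y : ∀ w : InfinitePlace K, (w.Completion)ˣ := fun w ↦
    ⟨(x : InfiniteAdeleRing K) w, ((x⁻¹ : (InfiniteAdeleRing K)ˣ) : InfiniteAdeleRing K) w,
      by rw [← InfiniteAdeleRing.mul_apply', Units.mul_inv, InfiniteAdeleRing.one_apply'],
      by rw [← InfiniteAdeleRing.mul_apply', Units.inv_mul, InfiniteAdeleRing.one_apply']⟩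
  refine ⟨y, fun w ↦ rfl, ?_⟩
  -- the coordinate homomorphisms of `𝕀_K` (finite part; complex coordinate at `w'`)
  let S : ideleGroup K →* FiniteAdeleRing (𝓞 K) K :=
    { toFun := fun z ↦ (z : AdeleRing (𝓞 K) K).2
      map_one' := rfl
      map_mul' := fun _ _ ↦ rfl }
  let E : InfinitePlace K → (ideleGroup K →* ℂ) := fun w' ↦
    { toFun := fun z ↦ Completion.extensionEmbedding w' ((z : AdeleRing (𝓞 K) K).1 w')
      map_one' := by
        change Completion.extensionEmbedding w' 1 = 1
        exact map_one _
      map_mul' := fun a b ↦ by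
        change Completion.extensionEmbedding w'
          ((a : AdeleRing (𝓞 K) K).1 w' * (b : AdeleRing (𝓞 K) K).1 w') = _
        exact map_mul _ _ _ }
  have hx : infiniteIdeles K x = ∏ w, infiniteIdeleSingle w (y w) := by
    refine idele_eq_of_snd_eq_of_extensionEmbedding_eq K ?_ fun w' ↦ ?_
    · change S (infiniteIdeles K x) = S (∏ w, infiniteIdeleSingle w (y w))
      rw [map_prod, Finset.prod_eq_one fun w _ ↦ ?_]
      · rfl
      · exact infiniteIdeleSingle_snd w (y w)
    · change E w' (infiniteIdeles K x) = E w' (∏ w, infiniteIdeleSingle w (y w))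
      rw [map_prod]
      have hfac : ∀ w, E w' (infiniteIdeleSingle w (y w)) =
          if w' = w then Completion.extensionEmbedding w' ((x : InfiniteAdeleRing K) w') else 1 := by
        intro w
        change Completion.extensionEmbedding w'
          (((infiniteIdeleSingle w (y w) : ideleGroup K) : AdeleRing (𝓞 K) K).1 w') = _
        by_cases h : w' = w
        · subst h
          rw [if_pos rfl, infiniteIdeleSingle_fst_self]
        · rw [if_neg h, infiniteIdeleSingle_fst_of_ne _ h, map_one]
      rw [Finset.prod_congr rfl fun w _ ↦ hfac w, Finset.prod_ite_eq, if_pos (Finset.mem_univ _)]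
      rfl
  rw [hx, map_prod]
  rfl

/-- **A Hecke character with integral exponents on the exponential ideles is algebraic** (`K`
totally complex): if `ψ(γ_K(a_w)) = e^{a A_w + ā B_w}` with integers `A_w, B_w` at every (complex)
place `w`, then `ψ((x, 1)) = ∏_w ι_w(x_w)^{A_w} \overline{ι_w(x_w)}^{B_w}` on all of `(K ⊗ ℝ)ˣ`
(`(x,1) = ∏_w (x_w)_w`, `(x_w)_w = γ_K((log ι_w x_w)_w)`), i.e. `ψ` has Weil type
`(-A, -B)`. [folklore] -/
theorem heckeCharacter_isAlgebraic_of_expIdele [IsTotallyComplex K] {ψ : HeckeCharacter K}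
    (A B : {w : InfinitePlace K // w.IsComplex} → ℤ)
    (hψ : ∀ (w : {w : InfinitePlace K // w.IsComplex}) (a : ℂ),
      ((ψ (Matrix.GeneralLinearGroup.det (GLn.ofInfinite 1 K
        (expGL (complexPlaceLie 1 w (a • (1 : Matrix (Fin 1) (Fin 1) ℂ)))))) : ℂˣ) : ℂ) =
        Complex.exp (a * A w + conj a * B w)) :
    ψ.IsAlgebraic := by
  have hc : ∀ w : InfinitePlace K, w.IsComplex := fun w ↦ IsTotallyComplex.isComplex w
  refine ⟨fun w ↦ -A ⟨w, hc w⟩, fun w ↦ -B ⟨w, hc w⟩, Set.univ, Filter.univ_mem, fun x _ ↦ ?_⟩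
  obtain ⟨y, hyx, hprod⟩ := heckeCharacter_infiniteIdeles_eq_prod ψ x
  rw [hprod, Units.coe_prod]
  refine Finset.prod_congr rfl fun w _ ↦ ?_
  simp only [neg_neg]
  set z : ℂ := Completion.extensionEmbedding w ((x : InfiniteAdeleRing K) w) with hz
  have hz0 : z ≠ 0 := InfiniteIdele.extensionEmbedding_apply_ne_zero x w
  have hy : Completion.extensionEmbedding w ((y w : (w.Completion)ˣ) : w.Completion) =
      Complex.exp (Complex.log z) := by
    rw [hyx, Complex.exp_log hz0]
  rw [HeckeCharacter.archComponent_apply, infiniteIdeleSingle_eq_expIdele ⟨w, hc w⟩ (y w) _ hy, hψ,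
    mul_comm (Complex.log z) _, mul_comm (conj (Complex.log z)) _, Complex.exp_add,
    Complex.exp_int_mul, Complex.exp_int_mul, Complex.exp_conj, Complex.exp_log hz0]

end Algebraic

section Rank

variable {F₀ F : Type} [Field F₀] [NumberField F₀] [Field F] [NumberField F] [Algebra F₀ F]

/-- **The crux data have positive rank**: the twist-nontriviality clause of `Hyps` exhibits two
Satake parameters of `π` with different twists, impossible for `n = 0` (both empty). [folklore] -/
theorem hyps_rank_pos {τ : F ≃ₐ[F₀] F} {n : ℕ} {hcpt : isCompact_glFiniteIntegralLevel n F}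
    {π : CuspidalAutomorphicRepData n F hcpt} {e : FramedGaloisRep F₀ ℂ 1} {k : ℤ} {ℓ : ℕ}
    {eψ : FramedGaloisRep F ℂ 1} (hH : Hyps τ n π e k ℓ eψ) : 0 < n := by
  obtain ⟨-, -, -, -, -, -, -, -, -, -, -, hnti⟩ := hH
  rcases Nat.eq_zero_or_pos n with h0 | hpos
  · exfalso
    subst h0
    obtain ⟨w, α, β, c, c', hα, hβ, -, -, hne⟩ := hnti.exists
    have hα0 : α = 0 := Multiset.card_eq_zero.mp hα.card_eq
    have hβ0 : β = 0 := Multiset.card_eq_zero.mp hβ.card_eq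
    exact hne (by rw [hα0, hβ0, Multiset.map_zero, Multiset.map_zero])
  · exact hpos

end Rank

/-- **Sub-stub ARCH (`stub_memberArch`; facts: archimedean base change `harch`, Henniart's
infinity type of an automorphic induction `hHen`, existence of infinity types `hinf`).**  From the
relations `MemberRel` alone: an infinity type `T` of `τ' = Π_K ⊗ ψ₀` with `ArchOut` — `T` weakly
regular (the `a`-exponents at `σ_u` are `{p_i + a_u} + {q_i + a_u}` with the `p_i` resp. `q_i` of the
regular `π` pairwise distinct: Henniart for `Π`, `hasInfinityType_baseChange` for `Π_K`, the `GL₁`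
twist `hasArchParameter_twist_glOne`), and the type-I criterion: the `a`-exponent of `ψ₀` at `σ_u`
is `a_u = (m_u + k)/2` with `(-1)^{m_u} = ψu((-1)_u) = χ₀((-1)_v)` (`archParam_complexPlace_glOne`,
the restriction identity, finite order of `χ₀`), so `χ₀,v(-1) = (-1)^{n+k}` for all `v` gives
`m_u + k ≡ n (mod 2)`, exponents in `½ + ℤ` (`C`-algebraic for `GL_{2n}`) and `ψ₁ = ψ₀ ν` of integral
type (algebraic). [cite: Clozel1990, §3.3] -/
theorem stub_memberArch : ArthurClozel1989_strongLifting_archimedean → Henniart2012_infinityType_of_automorphicInduction → (∀ (N : ℕ) (K : Type) [Field K] [NumberField K] (hK : isCompact_glFiniteIntegralLevel N K) (P : AutomorphicRepData (AutomorphyDatum.gl N K hK)), P.exists_hasInfinityType) → ∀ (F₀ F : Type) [Field F₀] [NumberField F₀] [Field F] [NumberField F] [Algebra F₀ F] (τ : F ≃ₐ[F₀] F) (n : ℕ) (hcpt : isCompact_glFiniteIntegralLevel n F) (π : CuspidalAutomorphicRepData n F hcpt) (e : FramedGaloisRep F₀ ℂ 1) (k : ℤ) (ℓ : ℕ) [Fact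 ℓ.Prime] (eψ : FramedGaloisRep F ℂ 1), Hyps τ n π e k ℓ eψ → ∀ (K : Type) [Field K] [NumberField K] [Algebra F₀ K] [IsCMField K], Module.finrank F₀ K = 2 → ∀ (L : Type) [Field L] [NumberField L] [Algebra F L] [Algebra K L] [IsGalois K L] (μ χe : HeckeCharacter F₀) (ω : HeckeCharacter F) (hfin : ω.IsFiniteOrder) (ω₀ : HeckeCharacter F₀) (ψu νk ν : HeckeCharacter K) (Pind : CuspidalAutomorphicRepData (2 * n) F₀ (isCompact_glFiniteIntegralLevel_holds (2 * n) F₀)) (PiK τ' : CuspidalAutomorphicRepData (2 * n) K (isCompact_glFiniteIntegralLevel_holds (2 * n) K)) (P₀ P : CuspidalAutomorphicRepData n L (isCompact_glFiniteIntegralLevel_holds n L)), MemberRel π e eψ k μ χe ω hfin ω₀ ψu νk ν Pind PiK τ' P₀ P → ∃ T : InfinityType K (2 * n), ArchOut k ((χe * ω₀)⁻¹ * μ) τ'.1 (ψu * νk * ν) T := by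
  intro harch hHen hinf F₀ F _ _ _ _ _ τ n hcpt π e k ℓ _ eψ hH K _ _ _ _ h2K L _ _ _ _ _ μ χe ω hfin ω₀
    ψu νk ν Pind PiK τ' P₀ P hrel
  have hn : 0 < n := hyps_rank_pos hH
  obtain ⟨hTR, hdeg, -, hreg, -⟩ := hH
  obtain ⟨-, -, -, -, hχ₀fin, -, hres, hνk, hν, hAI, hBC, hW, hW', -⟩ := hrel
  -- the quadratic extensions `F/F₀`, `K/F₀` are Galois and cyclic
  haveI : Algebra.IsQuadraticExtension F₀ F := ⟨hdeg⟩
  haveI : Module.Finite F₀ F := Module.Finite.of_restrictScalars_finite ℚ F₀ F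
  haveI : Algebra.IsSeparable F₀ F := Algebra.IsSeparable.of_integral F₀ F
  haveI : IsGalois F₀ F := Algebra.IsQuadraticExtension.isGalois F₀ F
  haveI : Algebra.IsQuadraticExtension F₀ K := ⟨h2K⟩
  haveI : Module.Finite F₀ K := Module.Finite.of_restrictScalars_finite ℚ F₀ K
  haveI : Algebra.IsSeparable F₀ K := Algebra.IsSeparable.of_integral F₀ K
  haveI : IsGalois F₀ K := Algebra.IsQuadraticExtension.isGalois F₀ K
  have hprimeK : (Module.finrank F₀ K).Prime := by
    rw [h2K]
    exact Nat.prime_two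
  -- Step 1: infinity types of `π ⊗ ω`, `Π`, `Π_K`
  obtain ⟨Tπ, hTπ, hTC, hTreg⟩ := hreg
  have hTπ' : (π.twist ω hfin).1.HasInfinityType Tπ :=
    ⟨hTπ.1, AutomorphicRepData.HasArchParameter.twist π.1 ω hfin hTπ.2⟩
  obtain ⟨TP0, hTP0⟩ := hinf (2 * n) F₀ _ Pind.1
  have hTPind : Pind.1.HasInfinityType (Tπ.automorphicInduction F₀ (2 * n)) :=
    hHen.hasInfinityType_automorphicInduction F₀ F (Algebra.IsQuadraticExtension.isCyclic F₀ F) n 2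
      hn hdeg _ _ Pind (π.twist ω hfin) hAI hTP0 hTπ'
  have hTPiK : PiK.1.HasInfinityType ((Tπ.automorphicInduction F₀ (2 * n)).baseChange K) :=
    harch.hasInfinityType_baseChange (Algebra.IsQuadraticExtension.isCyclic F₀ K) hprimeK hBC hTPind
  -- Step 2: the `GL₁` datum of `θ = ψu νk` and the infinity type of `τ' = Π_K ⊗ θ`
  obtain ⟨χ₁, p, hθ, hp, hpint⟩ := exists_glOne_archParam (hinf 1 K _) (ψu * νk)
  obtain ⟨T, hT, hTa, hTmem⟩ := exists_hasInfinityType_twist_glOne χ₁ hθ hp hpint hW hW' hTPiK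
  -- Step 3: the exponents of `θ` place by place
  have hc : ∀ u : InfinitePlace K, u.IsComplex := fun u ↦ IsTotallyComplex.isComplex u
  have huniq : ∀ u u' : InfinitePlace K,
      u'.comap (algebraMap F₀ K) = u.comap (algebraMap F₀ K) → u' = u :=
    fun u u' h ↦ paneArch_eq_of_comap_eq h2K (hc u) (hTR.isReal _) h
  have hplace : ∀ u : {u : InfinitePlace K // u.IsComplex}, ∃ m : ℤ,
      p u.1.embedding = ((k : ℂ) + m) / 2 ∧
      p (ComplexEmbedding.conjugate u.1.embedding) = ((k : ℂ) - m) / 2 ∧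
      ((((χe * ω₀)⁻¹ * μ).archComponent (u.1.comap (algebraMap F₀ K)) (-1) : ℂˣ) : ℂ) =
        (-1 : ℂ) ^ m :=
    fun u ↦ archParam_complexPlace_of_restrict χ₁ hθ hp hpint hres hχ₀fin hνk u (hTR.isReal _)
      (huniq u.1)
  choose m hm using hplace
  refine ⟨T, hT, fun σ ↦ ?_, fun hsgn ↦ ?_⟩
  · -- weak regularity: the two halves over `σ₁ ≠ σ₂`
    obtain ⟨σ₁, σ₂, -, -, -, hsum⟩ := exists_sum_filter_comp_eq_add_of_finrank_eq_two hdeg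
      (σ.comp (algebraMap F₀ K)) (fun σ' ↦ (Tπ σ').map ArchWeight.a)
    have hsum' : (∑ σ' ∈ Finset.univ.filter
        (fun σ' : F →+* ℂ ↦ σ'.comp (algebraMap F₀ F) = σ.comp (algebraMap F₀ K)),
          (Tπ σ').map ArchWeight.a) = (Tπ σ₁).map ArchWeight.a + (Tπ σ₂).map ArchWeight.a := hsum
    refine ⟨((Tπ σ₁).map ArchWeight.a).map (· + p σ), ((Tπ σ₂).map ArchWeight.a).map (· + p σ),
      ?_, ?_, ?_, ?_⟩
    · rw [hTa σ, InfinityType.baseChange_apply, InfinityType.map_automorphicInduction, hsum',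
        Multiset.map_add]
    · rw [Multiset.card_map, Multiset.card_map, hTπ.1.1 σ₁, Nat.mul_div_cancel_left n two_pos]
    · exact (hTreg σ₁).map (add_left_injective (p σ))
    · exact (hTreg σ₂).map (add_left_injective (p σ))
  · -- the type-I criterion: parities `m_u ≡ n + k`
    have hpar : ∀ u : {u : InfinitePlace K // u.IsComplex}, ∃ j : ℤ, m u = n + k + 2 * j := by
      intro u
      obtain ⟨-, -, hmu⟩ := hm u
      have h := (hsgn (u.1.comap (algebraMap F₀ K))).symm.trans hmu
      rcases Int.even_or_odd (m u - (n + k)) with ⟨j, hj⟩ | hodd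
      · exact ⟨j, by omega⟩
      · exfalso
        have h1 : (-1 : ℂ) ^ (m u - ((n : ℤ) + k)) = 1 := by
          rw [zpow_sub₀ (by norm_num : (-1 : ℂ) ≠ 0), ← h, div_self (zpow_ne_zero _ (by norm_num))]
        rw [hodd.neg_one_zpow] at h1
        norm_num at h1
    choose j hj using hpar
    -- `p σ ∈ n/2 + ℤ` for every `σ`
    have hpσ : ∀ σ : K →+* ℂ, ∃ i : ℤ, p σ = (i : ℂ) + (n : ℂ) / 2 := by
      intro σ
      obtain ⟨hp1, hp2, -⟩ := hm ⟨InfinitePlace.mk σ, hc _⟩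
      have hj' : ((m ⟨InfinitePlace.mk σ, hc _⟩ : ℤ) : ℂ) = n + k + 2 * j ⟨InfinitePlace.mk σ, hc _⟩ := by
        exact_mod_cast hj ⟨InfinitePlace.mk σ, hc _⟩
      dsimp only at hp1 hp2
      rcases mk_eq_iff.mp (mk_embedding (InfinitePlace.mk σ)) with h | h
      · rw [h] at hp1
        exact ⟨k + j ⟨InfinitePlace.mk σ, hc _⟩, by rw [hp1, hj']; push_cast; ring⟩
      · rw [h] at hp2
        exact ⟨-j ⟨InfinitePlace.mk σ, hc _⟩ - n, by rw [hp2, hj']; push_cast; ring⟩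
    refine ⟨fun σ wt hwt ↦ ?_, ?_⟩
    · -- `C`-algebraicity of `T`
      obtain ⟨w₀, hw₀, ha, hb⟩ := hTmem σ wt hwt
      rw [InfinityType.baseChange_apply, InfinityType.automorphicInduction_apply] at hw₀
      obtain ⟨σ', -, hw₀'⟩ := Multiset.mem_sum.mp hw₀
      obtain ⟨i, i', hi, hi'⟩ := hTC σ' w₀ hw₀'
      obtain ⟨i₁, hi₁⟩ := hpσ σ
      obtain ⟨i₂, hi₂⟩ := hpσ (ComplexEmbedding.conjugate σ)
      refine ⟨i + i₁, i' + i₂, ?_, ?_⟩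
      · rw [ha, hi, hi₁]
        push_cast
        ring
      · rw [hb, hi', hi₂]
        push_cast
        ring
    · -- algebraicity of `ψ₁ = θ ν`
      refine heckeCharacter_isAlgebraic_of_expIdele (fun u ↦ k + j u) (fun u ↦ -j u - n)
        fun u a ↦ ?_
      obtain ⟨hp1, hp2, -⟩ := hm u
      have hj' : ((m u : ℤ) : ℂ) = n + k + 2 * j u := by exact_mod_cast hj u
      rw [HeckeCharacter.mul_apply, Units.val_mul, glOne_apply_expIdele_complexPlace χ₁ hθ hp u a,
        normChar_apply_expIdele_complexPlace hν u a, ← Complex.exp_add, hp1, hp2, hj']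
      congr 1
      push_cast
      ring

end Summit.Langlands.Langlands.Theorems.HostInducedRep.OneTransparentPane

end
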